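import Summits.AtomisticToContinuum.Crystallization.Theses.HullExactificationCascade
import Summits.AtomisticToContinuum.Crystallization.Theorems.HullExactificationCascadeRobustBarlowTemplateDefs
import Summits.AtomisticToContinuum.Crystallization.Theorems.HullExactificationCascadeRobustBarlowTemplateTransportDefs
import Summits.AtomisticToContinuum.Crystallization.Theorems.HullExactificationCascadeRobustBarlowTemplateStubReciprocity
import Summits.AtomisticToContinuum.Crystallization.Theorems.HullExactificationCascadeRobustBarlowTemplateStubExhaust
import Summits.AtomisticToContinuum.Crystallization.Theorems.HullExactificationCascadeRobustBarlowTemplateDevelopTransport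
import Summits.AtomisticToContinuum.Crystallization.Theorems.HullExactificationCascadeRobustBarlowTemplateDevelopCovering
import Summits.AtomisticToContinuum.Crystallization.Theorems.HullExactificationCascadeRobustBarlowTemplateDevelopLocSim
import Summits.AtomisticToContinuum.Crystallization.Theorems.HullExactificationCascadeRobustBarlowTemplateDevelopInjective

/-!
# `RobustBarlowTemplate` (crux C of route `HullExactificationCascade`, item stmt-AtomisticToContinuum-12088) — PROVED

Closing file of the line `registered` (`Cruxes/RobustBarlowTemplate/Lines/birth.lean`) for the crux
`Summit.AtomisticToContinuum.Crystallization.Theses.HullExactificationCascade.RobustBarlowTemplate`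
(shared with route `DisclinationRation`): for every `δ > 0`, every nonempty `δ`-separated `S ⊆ ℝ³`
all of whose points are `1/20`-good is the bijective image of the ideal Barlow stacking
`barlowStacking 1 √(2/3) s` of some Hägg sequence `s` under a map that is `1/20`-close to a
similarity on every unit cluster — the robust form of Hales, *Dense Sphere Packings* §1.3
(`HalesDSP_layerPackings_holds`).

## The three movements (all landed under `Theorems/HullExactificationCascadeRobustBarlowTemplate*.lean`)

1. `stub_reciprocity` — shells are reciprocal with comparable scales (60° covering bound of both
   kissing patterns).
2. `stub_develop` (here, from four landed pieces) — DEVELOPMENT of an ideal stacking inside `S`: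
   integer charts with exact links (`develop_charts`, `develop_zchart`), the transfer lemma at
   tolerance `1/20` (`develop_transfer`), the transport system (`develop_transport`: port at 1/20 of
   the closed sibling crux 9227 `ShellsToBarlowChart`), the shell covering (`develop_covering`),
   its metric clause (`develop_locsim`: pattern rigidity) and its INJECTIVITY (`develop_injective`:
   the piecewise-affine extension over the refined tetrahedral–octahedral honeycomb is a covering
   map of the simply connected `ℝ³` — the hard floor `δ` makes it uniformly co-Lipschitz).
3. `stub_exhaust` — a nonempty shell-closed subset of an everywhere-good separated configuration
   is everything (descent), hence the shell-closed template is onto.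

`robustBarlowTemplate_proof` concludes the crux BY NAME; the crux's inlined `let d / let T`
predicates are `nnd`/`shell`/`Good` and its conclusion is `Set.BijOn … ∧ LocSim …` by definitional
unfolding (vocabulary files `…RobustBarlowTemplateDefs`, `…TransportDefs`).
-/

noncomputable section

namespace Summit.AtomisticToContinuum.Crystallization.Theorems

namespace HullExactificationCascadeRobustBarlowTemplate

open Literature.MathematicalPhysics.StatisticalMechanics Literature.Geometry.DiscreteGeometry

/-- Euclidean `3`-space. -/
local notation "E3" => EuclideanSpace ℝ (Fin 3)

/-- **Movement 2 — robust layer propagation** (the line's `stub_develop`, assembled): an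
everywhere-good separated nonempty configuration with reciprocal shells contains an injective,
shell-closed, locally `1/20`-similar copy of an ideal Barlow stacking of some Hägg sequence.
The transport system (`develop_transport`) is developed into a shell covering `Ψ`
(`develop_covering`), which is locally similar (`develop_locsim`) and injective
(`develop_injective`); `MapsTo` is part of the covering and shell-closedness is star-surjectivity. -/
theorem robust_develop :
    ∀ δ : ℝ, 0 < δ → ∀ S : Set E3, S.Nonempty → Sep δ S → (∀ y ∈ S, Good S y) → Recip S →
      ∃ s : ℤ → ℤ, IsHaggSeq s ∧ ∃ Φ : E3 → E3, Set.MapsTo Φ (idealStacking s) S ∧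
        Set.InjOn Φ (idealStacking s) ∧ LocSim s Φ ∧ ShellClosed S s Φ := by
  intro δ hδ S hne hsep hgood hR
  obtain ⟨s, hs, Ψ, hcov⟩ := develop_covering S (develop_transport δ hδ S hne hsep hgood hR)
  have hloc : LocSim s Ψ := develop_locsim δ hδ S hsep hgood hR s Ψ hs hcov
  have hinj : Set.InjOn Ψ (idealStacking s) :=
    develop_injective δ hδ S hsep hgood hR s Ψ hs hcov hloc
  refine ⟨s, hs, Ψ, hcov.1, hinj, hloc, ?_⟩
  intro p hp z hz
  obtain ⟨q, hq, rfl⟩ := (hcov.2.1 p hp).surjOn hz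
  exact ⟨q, hq.1, rfl⟩

/-- **Composition of the three movements** (pure logic): reciprocity, then the developed
template `Φ`, then exhaustion applied to `M = Φ '' stacking` gives surjectivity, hence
`Set.BijOn`. -/
theorem robust_composition :
    ∀ δ : ℝ, 0 < δ → ∀ S : Set E3, S.Nonempty → Sep δ S → (∀ y ∈ S, Good S y) →
      ∃ s : ℤ → ℤ, IsHaggSeq s ∧ ∃ Φ : E3 → E3, Set.BijOn Φ (idealStacking s) S ∧ LocSim s Φ := by
  intro δ hδ S hne hsep hgood
  -- movement 1: reciprocity of shells
  have hR : Recip S := stub_reciprocity δ hδ S hsep hgood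
  -- movement 2: develop the template inside `S`
  obtain ⟨s, hs, Φ, hmaps, hinj, hloc, hclosed⟩ := robust_develop δ hδ S hne hsep hgood hR
  -- movement 3: the template is a nonempty shell-closed subset, hence exhausts `S`
  have hMsub : Φ '' idealStacking s ⊆ S := hmaps.image_subset
  have hMne : (Φ '' idealStacking s).Nonempty :=
    ⟨Φ (barlowPos 1 (Real.sqrt (2 / 3)) s 0 0 0),
      Set.mem_image_of_mem Φ (barlowPos_mem (a := 1) (h := Real.sqrt (2 / 3)) (s := s) 0 0 0)⟩
  have hMclosed : ∀ x ∈ Φ '' idealStacking s, shell S x ⊆ Φ '' idealStacking s := by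
    rintro _ ⟨p, hp, rfl⟩
    exact hclosed p hp
  have hsurj : Set.SurjOn Φ (idealStacking s) S :=
    stub_exhaust δ hδ S hsep hgood hR (Φ '' idealStacking s) hMsub hMne hMclosed
  exact ⟨s, hs, Φ, ⟨hmaps, hinj, hsurj⟩, hloc⟩

end HullExactificationCascadeRobustBarlowTemplate

/-- **`RobustBarlowTemplate` holds** (crux C of route `HullExactificationCascade`, item
stmt-AtomisticToContinuum-12088, shared with route `DisclinationRation`): for every `δ > 0`, every
nonempty `δ`-separated `S ⊆ ℝ³` all of whose points are `1/20`-good is the bijective image of the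
ideal Barlow stacking `barlowStacking 1 √(2/3) s` of some Hägg sequence `s` under a map that is
`1/20`-close to a similarity on every unit cluster.  The type is LITERALLY the route decl; the
crux's inlined `let d / let T` hypothesis is `Good` and its conclusion is `Set.BijOn … ∧ LocSim …`
by definitional unfolding. -/
theorem robustBarlowTemplate_proof :
    Summit.AtomisticToContinuum.Crystallization.Theses.HullExactificationCascade.RobustBarlowTemplate := by
  intro δ hδ S hne hsep hgood
  obtain ⟨s, hs, Φ, hbij, hloc⟩ :=
    HullExactificationCascadeRobustBarlowTemplate.robust_composition δ hδ S hne hsep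
      (fun y hy => hgood y hy)
  exact ⟨s, hs, Φ, hbij, hloc⟩

end Summit.AtomisticToContinuum.Crystallization.Theorems

end
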